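import Summits.CriticalPhenomena.PercolationContinuityZ3.Theorems.PercNearOneGluingNoHeavyLowerTailConditionedChampionExchange
import Summits.CriticalPhenomena.PercolationContinuityZ3.Theorems.PercNearOneGluingNoHeavyLowerTailAttachedChampion
import HarnessLib

/-!
# `NoHeavyLowerTail` (stmt-CriticalPhenomena-4575) — the RESTRICTED-ATTACHMENT EXCHANGE (REX): typed reduction to the crux,
# and its proved one-relay case

Support file (lemma factory #8 `prim-lf-8`, gen 7; `--supports stmt-CriticalPhenomena-4575`).  No definitions, no named facts,
no sorries.  `μ = prodBernoulli w` on `Fin n`, relays `A`, level `j`, `π(v) = {a ∈ A : v ↔ a}`, `N = |π(o)|`, `S(a) = μ(|π(a)| ≤ j)`.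

**REX (restricted-attachment exchange; conjecture, prim-lf-8 CANDIDATES v8 B8-6).**  For every weighted graph, every `q ∈ A`, every set
`Q ⊆ A ∖ q` that `q` BEATS (`S(x) ≤ S(q)` for `x ∈ Q` — `q` need not be a champion) and every vertex `o ∉ A`:

  `μ(o ↔ Q, 1 ≤ N ≤ j, |π(q)| > j) ≤ μ(o ↔ Q, N > j, |π(q)| ≤ j)`      (`{o ↔ Q} = ⋃_{x ∈ Q} {o ↔ x}`),

"given that the observer hangs on `Q`, the heavy block sits on the observer's side at least as often as on `q`'s".
* `|Q| = 1` is the conditioned championship exchange (`conditionedChampionExchange_swap`, PROVED) — `rex_singleton` below;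
* `Q = A ∖ q` with `q` a champion is EXACTLY the attached-champion inequality XZ (`hAC` of `noHeavyLowerTail_of_attachedChampion`),
  hence REX ⇒ XZ ⇒ cumulative isolation ⇒ `NoHeavyLowerTail` — `attachedChampion_of_rex`, `noHeavyLowerTail_of_rex` below;
* seat census (exact, code/lab-gen7/rex_screen.py, t5_screen.py, climb_rex.py): 0 violations in 45 000 (graph, j, q, Q, o) cases over all
  cells with `|A| ≤ 7`, `o` a non-relay OR a relay outside `Q ∪ q`, `q` beating `Q` only; the finer splits by the exact pocket
  `π(o) ∩ Q = Z` (ZEX) and the complement form (CREX) are FALSE, so REX is the exclusion-free (monotone) statement.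
REX's hypothesis is local (`q` beats `Q` only), which is what makes an induction on `|Q|` conceivable; the step `|Q| = 1 → 2` is open.
-/

noncomputable section

namespace Summit.CriticalPhenomena.PercolationContinuityZ3.Theorems

open MeasureTheory Set Literature.Probability.LatticeModels Literature.Probability.Percolation
open scoped Classical BigOperators

variable {n : ℕ}

namespace RestrictedAttachmentExchange

/-- **REX at a single relay is the conditioned championship exchange** (PROVED case `Q = {x}`): if `S(x) ≤ S(q)` then
`μ(o↔x, 1 ≤ N ≤ j, |π(q)| > j) ≤ μ(o↔x, N > j, |π(q)| ≤ j)`. [this work] -/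
theorem rex_singleton (w : Sym2 (Fin n) → unitInterval) (A : Finset (Fin n)) (o x q : Fin n) (j : ℕ)
    (hS : (prodBernoulli w).real {ω : BondConfig (Fin n) | (A.filter fun a => ω ∈ openConn x a).card ≤ j} ≤
      (prodBernoulli w).real {ω : BondConfig (Fin n) | (A.filter fun a => ω ∈ openConn q a).card ≤ j}) :
    (prodBernoulli w).real ((openConn o x : Set (BondConfig (Fin n))) ∩
        {ω | 1 ≤ (A.filter fun a => ω ∈ openConn o a).card ∧ (A.filter fun a => ω ∈ openConn o a).card ≤ j} ∩
        {ω | j < (A.filter fun a => ω ∈ openConn q a).card}) ≤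
      (prodBernoulli w).real ((openConn o x : Set (BondConfig (Fin n))) ∩
        {ω | j < (A.filter fun a => ω ∈ openConn o a).card} ∩
        {ω | (A.filter fun a => ω ∈ openConn q a).card ≤ j}) := by
  have key := conditionedChampionExchange_swap w A o x q j hS
  have e1 : ((openConn o x : Set (BondConfig (Fin n))) ∩
        {ω | 1 ≤ (A.filter fun a => ω ∈ openConn o a).card ∧ (A.filter fun a => ω ∈ openConn o a).card ≤ j} ∩
        {ω | j < (A.filter fun a => ω ∈ openConn q a).card}) ⊆
      ((openConn o x : Set (BondConfig (Fin n))) ∩ {ω | (A.filter fun a => ω ∈ openConn x a).card ≤ j} ∩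
        {ω | j < (A.filter fun a => ω ∈ openConn q a).card}) := by
    rintro ω ⟨⟨hox, -, hle⟩, hq⟩
    refine ⟨⟨hox, ?_⟩, hq⟩
    show (A.filter fun a => ω ∈ openConn x a).card ≤ j
    rw [← ConditionedChampionExchange.filter_eq_of_openConn A hox]; exact hle
  have e2 : ((openConn o x : Set (BondConfig (Fin n))) ∩ {ω | j < (A.filter fun a => ω ∈ openConn x a).card} ∩
        {ω | (A.filter fun a => ω ∈ openConn q a).card ≤ j}) ⊆
      ((openConn o x : Set (BondConfig (Fin n))) ∩ {ω | j < (A.filter fun a => ω ∈ openConn o a).card} ∩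
        {ω | (A.filter fun a => ω ∈ openConn q a).card ≤ j}) := by
    rintro ω ⟨⟨hox, hx⟩, hq⟩
    refine ⟨⟨hox, ?_⟩, hq⟩
    show j < (A.filter fun a => ω ∈ openConn o a).card
    rw [ConditionedChampionExchange.filter_eq_of_openConn A hox]; exact hx
  exact le_trans (measureReal_mono e1 (measure_ne_top _ _)) (le_trans key (measureReal_mono e2 (measure_ne_top _ _)))

/-- **REX ⇒ the attached-champion inequality XZ.**  The case `Q = A ∖ q`, `q` a champion, of the restricted-attachment exchange
is `μ(1 ≤ N ≤ j) ≤ μ(|π(q)| ≤ j ∧ 1 ≤ N)` (subtract the common event `{1 ≤ N ≤ j} ∩ {|π(q)| ≤ j}`). [this work] -/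
theorem attachedChampion_of_rex
    (hREX : ∀ (n : ℕ) (w : Sym2 (Fin n) → unitInterval) (A Q : Finset (Fin n)) (o q : Fin n) (j : ℕ),
      o ∉ A → q ∈ A → Q ⊆ A.erase q →
      (∀ x ∈ Q, (prodBernoulli w).real {ω : BondConfig (Fin n) | (A.filter fun a => ω ∈ openConn x a).card ≤ j} ≤
        (prodBernoulli w).real {ω : BondConfig (Fin n) | (A.filter fun a => ω ∈ openConn q a).card ≤ j}) →
      (prodBernoulli w).real ((⋃ x ∈ Q, (openConn o x : Set (BondConfig (Fin n)))) ∩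
          {ω | 1 ≤ (A.filter fun a => ω ∈ openConn o a).card ∧ (A.filter fun a => ω ∈ openConn o a).card ≤ j} ∩
          {ω | j < (A.filter fun a => ω ∈ openConn q a).card}) ≤
        (prodBernoulli w).real ((⋃ x ∈ Q, (openConn o x : Set (BondConfig (Fin n)))) ∩
          {ω | j < (A.filter fun a => ω ∈ openConn o a).card} ∩
          {ω | (A.filter fun a => ω ∈ openConn q a).card ≤ j}))
    (n : ℕ) (w : Sym2 (Fin n) → unitInterval) (A : Finset (Fin n)) (o q : Fin n) (j : ℕ) (ho : o ∉ A) (hq : q ∈ A)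
    (hchamp : ∀ a ∈ A,
      (prodBernoulli w).real {ω : BondConfig (Fin n) | (A.filter fun x => ω ∈ openConn a x).card ≤ j} ≤
        (prodBernoulli w).real {ω : BondConfig (Fin n) | (A.filter fun x => ω ∈ openConn q x).card ≤ j}) :
    (prodBernoulli w).real {ω : BondConfig (Fin n) |
        1 ≤ (A.filter fun x => ω ∈ openConn o x).card ∧ (A.filter fun x => ω ∈ openConn o x).card ≤ j} ≤
      (prodBernoulli w).real {ω : BondConfig (Fin n) |
        (A.filter fun x => ω ∈ openConn q x).card ≤ j ∧ 1 ≤ (A.filter fun x => ω ∈ openConn o x).card} := by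
  set μ := prodBernoulli w with hμ
  set L : Set (BondConfig (Fin n)) := {ω | 1 ≤ (A.filter fun x => ω ∈ openConn o x).card ∧
    (A.filter fun x => ω ∈ openConn o x).card ≤ j} with hL
  set Rq : Set (BondConfig (Fin n)) := {ω | (A.filter fun x => ω ∈ openConn q x).card ≤ j} with hRq
  set Hq : Set (BondConfig (Fin n)) := {ω | j < (A.filter fun x => ω ∈ openConn q x).card} with hHq
  set Ho : Set (BondConfig (Fin n)) := {ω | j < (A.filter fun x => ω ∈ openConn o x).card} with hHo
  set V : Set (BondConfig (Fin n)) := {ω | (A.filter fun x => ω ∈ openConn q x).card ≤ j ∧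
    1 ≤ (A.filter fun x => ω ∈ openConn o x).card} with hV
  set U : Set (BondConfig (Fin n)) := ⋃ x ∈ A.erase q, (openConn o x : Set (BondConfig (Fin n))) with hU
  have hmeas : ∀ s : Set (BondConfig (Fin n)), MeasurableSet s := fun _ => MeasurableSet.of_discrete
  have key := hREX n w A (A.erase q) o q j ho hq subset_rfl (fun x hx => hchamp x (Finset.mem_of_mem_erase hx))
  change μ.real (U ∩ L ∩ Hq) ≤ μ.real (U ∩ Ho ∩ Rq) at key
  -- `L = (L ∩ Rq) ⊔ (L \ Rq)` and `V = (L ∩ Rq) ⊔ (V \ L)`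
  have s1 : μ.real L = μ.real (L ∩ Rq) + μ.real (L \ Rq) :=
    (measureReal_inter_add_sdiff (μ := μ) (s := L) (t := Rq) (hmeas _)).symm
  have s2 : μ.real V = μ.real (V ∩ L) + μ.real (V \ L) :=
    (measureReal_inter_add_sdiff (μ := μ) (s := V) (t := L) (hmeas _)).symm
  have e1 : V ∩ L = L ∩ Rq := by
    ext ω; simp only [mem_inter_iff, hV, hL, hRq, mem_setOf_eq]; tauto
  -- `L \ Rq ⊆ U ∩ L ∩ Hq`: an attached light observer facing a heavy `q` is attached to a relay other than `q`
  have i1 : L \ Rq ⊆ U ∩ L ∩ Hq := by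
    rintro ω ⟨hl, hr⟩
    have hq' : j < (A.filter fun x => ω ∈ openConn q x).card := not_le.1 hr
    refine ⟨⟨?_, hl⟩, hq'⟩
    obtain ⟨h1, hle⟩ := hl
    obtain ⟨a, ha⟩ := Finset.card_pos.1 (by omega : 0 < (A.filter fun x => ω ∈ openConn o x).card)
    rw [Finset.mem_filter] at ha
    have haq : a ≠ q := by
      rintro rfl
      have e := ConditionedChampionExchange.filter_eq_of_openConn A ha.2
      rw [e] at hle
      exact absurd hle (not_le.2 hq')
    rw [hU]
    exact mem_biUnion (Finset.mem_erase.2 ⟨haq, ha.1⟩) ha.2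
  -- `U ∩ Ho ∩ Rq ⊆ V \ L`
  have i2 : U ∩ Ho ∩ Rq ⊆ V \ L := by
    rintro ω ⟨⟨-, hho⟩, hr⟩
    have hho' : j < (A.filter fun x => ω ∈ openConn o x).card := hho
    refine ⟨⟨hr, by omega⟩, ?_⟩
    rintro ⟨-, hle⟩
    exact absurd hle (not_le.2 hho')
  have m1 := measureReal_mono (μ := μ) i1 (measure_ne_top _ _)
  have m2 := measureReal_mono (μ := μ) i2 (measure_ne_top _ _)
  rw [s1, s2, e1]
  linarith

/-- **REX closes the crux.**  The restricted-attachment exchange (for all graphs, levels, `q` beating `Q`, `o ∉ A`) implies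
`NoHeavyLowerTail`, through XZ (`attachedChampion_of_rex`) and the lead's `noHeavyLowerTail_of_attachedChampion`. [this work] -/
theorem noHeavyLowerTail_of_rex
    (hREX : ∀ (n : ℕ) (w : Sym2 (Fin n) → unitInterval) (A Q : Finset (Fin n)) (o q : Fin n) (j : ℕ),
      o ∉ A → q ∈ A → Q ⊆ A.erase q →
      (∀ x ∈ Q, (prodBernoulli w).real {ω : BondConfig (Fin n) | (A.filter fun a => ω ∈ openConn x a).card ≤ j} ≤
        (prodBernoulli w).real {ω : BondConfig (Fin n) | (A.filter fun a => ω ∈ openConn q a).card ≤ j}) →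
      (prodBernoulli w).real ((⋃ x ∈ Q, (openConn o x : Set (BondConfig (Fin n)))) ∩
          {ω | 1 ≤ (A.filter fun a => ω ∈ openConn o a).card ∧ (A.filter fun a => ω ∈ openConn o a).card ≤ j} ∩
          {ω | j < (A.filter fun a => ω ∈ openConn q a).card}) ≤
        (prodBernoulli w).real ((⋃ x ∈ Q, (openConn o x : Set (BondConfig (Fin n)))) ∩
          {ω | j < (A.filter fun a => ω ∈ openConn o a).card} ∩
          {ω | (A.filter fun a => ω ∈ openConn q a).card ≤ j})) :
    Summit.CriticalPhenomena.PercolationContinuityZ3.Theses.PercNearOneGluing.NoHeavyLowerTail :=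
  noHeavyLowerTail_of_attachedChampion fun n w A o q j ho hq hchamp =>
    attachedChampion_of_rex hREX n w A o q j ho hq hchamp

end RestrictedAttachmentExchange

end Summit.CriticalPhenomena.PercolationContinuityZ3.Theorems

end
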